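import Mathlib

/-!
# Corner inequality `A/mj+mjp` — certificate chunks, part 3
(blind cell PercRepro2, night-2 g28; proofs/NIGHT2-DARC.md §70.7)
-/

namespace Summit.Ventures.PercRepro2.Coin

section JpCornerPart

variable {R : Type*} [Field R] [LinearOrder R] [IsStrictOrderedRing R]

omit [LinearOrder R] [IsStrictOrderedRing R] in
set_option maxHeartbeats 3200000 in
set_option maxRecDepth 100000 in
/-- Chunk 10 of the certificate identity. -/
lemma jp_corner_mj_mjp_chunk10_eq (_cO _cM _cJ _cMJ cJP _cMJP cJJP _cMJJP _uO uM uJ uMJ uJP uMJP uJJP uMJJP : R) :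
    (2 : R) * uM * uMJ * uMJP ^ 2 * uJJP + (2 : R) * uM * uJ * uMJ * uMJP ^ 2 + (2 : R) * cJJP * uMJ ^ 2 * uMJP * uJJP + (2 : R) * cJJP * uMJ ^ 2 * uMJP ^ 2 + (2 : R) * cJJP * uM * uJP * uMJJP ^ 2 + (2 : R) * cJJP * uM * uJP * uMJP * uMJJP + (2 : R) * cJJP * uM * uMJ * uMJP * uJJP + (2 : R) * cJJP * uM * uMJ * uJP * uMJP + (2 : R) * cJJP ^ 2 * uMJ * uMJP * uMJJP + (2 : R) * cJJP ^ 2 * uMJ * uMJP ^ 2 + (2 : R) * cJJP ^ 2 * uMJ ^ 2 * uMJP + (2 : R) * cJJP ^ 2 * uM * uJP * uMJJP + (2 : R) * cJJP ^ 2 * uM * uJ * uMJJP + (2 : R) * cJJP ^ 3 * uMJ * uMJP + (2 : R) * cJP * uMJ * uMJP ^ 2 * uJJP + (2 : R) * cJP * uJ * uMJ * uMJP ^ 2 + (2 : R) * cJP * uM * uJ * uMJ * uMJJP + (2 : R) * cJP * uM * uJ * uMJ * uMJP + (2 : R) * cJP * cJJP * uM * uJP * uMJJP + (2 : R) * cJP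 * cJJP ^ 2 * uMJ * uMJP = (2 : R) * (cJP * cJJP * (uM * uJP * uMJJP)) + (2 : R) * (cJP * cJJP * (cJJP * uMJ * uMJP)) + (2 : R) * (cJP * uM * (uJ * uMJ * uMJJP)) + (2 : R) * (cJP * uM * (uJ * uMJ * uMJP)) + (2 : R) * (cJP * uJ * (uMJ * uMJP ^ 2)) + (2 : R) * (cJP * uMJ * (uMJP ^ 2 * uJJP)) + (2 : R) * (cJJP * cJJP * (uMJ * uMJP * uMJJP)) + (2 : R) * (cJJP * cJJP * (uMJ * uMJP ^ 2)) + (2 : R) * (cJJP * cJJP * (uMJ ^ 2 * uMJP)) + (2 : R) * (cJJP * cJJP * (uM * uJP * uMJJP)) + (2 : R) * (cJJP * cJJP * (uM * uJ * uMJJP)) + (2 : R) * (cJJP * cJJP * (cJJP * uMJ * uMJP)) + (2 : R) * (cJJP * uM * (uJP * uMJJP ^ 2)) + (2 : R) * (cJJP * uM * (uJP * uMJP * uMJJP)) + (2 : R) * (cJJP * uM * (uMJ * uMJP * uJJP)) + (2 : R) * (cJJP * uM * (uMJ * uJP * uMJP)) + (2 : R) * (cJJP * uMJ * (uMJ * uMJP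 * uJJP)) + (2 : R) * (cJJP * uMJ * (uMJ * uMJP ^ 2)) + (2 : R) * (uM * uJ * (uMJ * uMJP ^ 2)) + (2 : R) * (uM * uMJ * (uMJP ^ 2 * uJJP)) := by
  ring

set_option maxHeartbeats 3200000 in
set_option maxRecDepth 100000 in
/-- Chunk 10 of the certificate is nonnegative. -/
lemma jp_corner_mj_mjp_chunk10_nonneg (cO cM cJ cMJ cJP cMJP cJJP cMJJP uO uM uJ uMJ uJP uMJP uJJP uMJJP : R)
    (_hcO : 0 ≤ cO) (_hcM : 0 ≤ cM) (_hcJ : 0 ≤ cJ) (_hcMJ : 0 ≤ cMJ) (_hcJP : 0 ≤ cJP) (_hcMJP : 0 ≤ cMJP) (_hcJJP : 0 ≤ cJJP) (_hcMJJP : 0 ≤ cMJJP) (_huO : 0 ≤ uO) (_huM : 0 ≤ uM) (_huJ : 0 ≤ uJ) (_huMJ : 0 ≤ uMJ) (_huJP : 0 ≤ uJP) (_huMJP : 0 ≤ uMJP) (_huJJP : 0 ≤ uJJP) (_huMJJP : 0 ≤ uMJJP)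
    (_hord_o : uO ≤ cO) (_hord_m : uM ≤ cM) (_hord_j : uJ ≤ cJ) (_hord_mj : uMJ ≤ cMJ) (_hord_jp : uJP ≤ cJP) (_hord_mjp : uMJP ≤ cMJP) (_hord_jjp : uJJP ≤ cJJP) (_hord_mjjp : uMJJP ≤ cMJJP)
     :
    0 ≤ (2 : R) * uM * uMJ * uMJP ^ 2 * uJJP + (2 : R) * uM * uJ * uMJ * uMJP ^ 2 + (2 : R) * cJJP * uMJ ^ 2 * uMJP * uJJP + (2 : R) * cJJP * uMJ ^ 2 * uMJP ^ 2 + (2 : R) * cJJP * uM * uJP * uMJJP ^ 2 + (2 : R) * cJJP * uM * uJP * uMJP * uMJJP + (2 : R) * cJJP * uM * uMJ * uMJP * uJJP + (2 : R) * cJJP * uM * uMJ * uJP * uMJP + (2 : R) * cJJP ^ 2 * uMJ * uMJP * uMJJP + (2 : R) * cJJP ^ 2 * uMJ * uMJP ^ 2 + (2 : R) * cJJP ^ 2 * uMJ ^ 2 * uMJP + (2 : R) * cJJP ^ 2 * uM * uJP * uMJJP + (2 : R) * cJJP ^ 2 * uM * uJ * uMJJP + (2 : R) * cJJP ^ 3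 * uMJ * uMJP + (2 : R) * cJP * uMJ * uMJP ^ 2 * uJJP + (2 : R) * cJP * uJ * uMJ * uMJP ^ 2 + (2 : R) * cJP * uM * uJ * uMJ * uMJJP + (2 : R) * cJP * uM * uJ * uMJ * uMJP + (2 : R) * cJP * cJJP * uM * uJP * uMJJP + (2 : R) * cJP * cJJP ^ 2 * uMJ * uMJP := by
  rw [jp_corner_mj_mjp_chunk10_eq cO cM cJ cMJ cJP cMJP cJJP cMJJP uO uM uJ uMJ uJP uMJP uJJP uMJJP]
  have H200 := mul_nonneg (mul_nonneg (by positivity : (0:R) ≤ cJP) (by positivity : (0:R) ≤ cJJP)) (by positivity : (0:R) ≤ uM * uJP * uMJJP)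
  have H201 := mul_nonneg (mul_nonneg (by positivity : (0:R) ≤ cJP) (by positivity : (0:R) ≤ cJJP)) (by positivity : (0:R) ≤ cJJP * uMJ * uMJP)
  have H202 := mul_nonneg (mul_nonneg (by positivity : (0:R) ≤ cJP) (by positivity : (0:R) ≤ uM)) (by positivity : (0:R) ≤ uJ * uMJ * uMJJP)
  have H203 := mul_nonneg (mul_nonneg (by positivity : (0:R) ≤ cJP) (by positivity : (0:R) ≤ uM)) (by positivity : (0:R) ≤ uJ * uMJ * uMJP)
  have H204 := mul_nonneg (mul_nonneg (by positivity : (0:R) ≤ cJP) (by positivity : (0:R) ≤ uJ)) (by positivity : (0:R) ≤ uMJ * uMJP ^ 2)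
  have H205 := mul_nonneg (mul_nonneg (by positivity : (0:R) ≤ cJP) (by positivity : (0:R) ≤ uMJ)) (by positivity : (0:R) ≤ uMJP ^ 2 * uJJP)
  have H206 := mul_nonneg (mul_nonneg (by positivity : (0:R) ≤ cJJP) (by positivity : (0:R) ≤ cJJP)) (by positivity : (0:R) ≤ uMJ * uMJP * uMJJP)
  have H207 := mul_nonneg (mul_nonneg (by positivity : (0:R) ≤ cJJP) (by positivity : (0:R) ≤ cJJP)) (by positivity : (0:R) ≤ uMJ * uMJP ^ 2)
  have H208 := mul_nonneg (mul_nonneg (by positivity : (0:R) ≤ cJJP) (by positivity : (0:R) ≤ cJJP)) (by positivity : (0:R) ≤ uMJ ^ 2 * uMJP)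
  have H209 := mul_nonneg (mul_nonneg (by positivity : (0:R) ≤ cJJP) (by positivity : (0:R) ≤ cJJP)) (by positivity : (0:R) ≤ uM * uJP * uMJJP)
  have H210 := mul_nonneg (mul_nonneg (by positivity : (0:R) ≤ cJJP) (by positivity : (0:R) ≤ cJJP)) (by positivity : (0:R) ≤ uM * uJ * uMJJP)
  have H211 := mul_nonneg (mul_nonneg (by positivity : (0:R) ≤ cJJP) (by positivity : (0:R) ≤ cJJP)) (by positivity : (0:R) ≤ cJJP * uMJ * uMJP)
  have H212 := mul_nonneg (mul_nonneg (by positivity : (0:R) ≤ cJJP) (by positivity : (0:R) ≤ uM)) (by positivity : (0:R) ≤ uJP * uMJJP ^ 2)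
  have H213 := mul_nonneg (mul_nonneg (by positivity : (0:R) ≤ cJJP) (by positivity : (0:R) ≤ uM)) (by positivity : (0:R) ≤ uJP * uMJP * uMJJP)
  have H214 := mul_nonneg (mul_nonneg (by positivity : (0:R) ≤ cJJP) (by positivity : (0:R) ≤ uM)) (by positivity : (0:R) ≤ uMJ * uMJP * uJJP)
  have H215 := mul_nonneg (mul_nonneg (by positivity : (0:R) ≤ cJJP) (by positivity : (0:R) ≤ uM)) (by positivity : (0:R) ≤ uMJ * uJP * uMJP)
  have H216 := mul_nonneg (mul_nonneg (by positivity : (0:R) ≤ cJJP) (by positivity : (0:R) ≤ uMJ)) (by positivity : (0:R) ≤ uMJ * uMJP * uJJP)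
  have H217 := mul_nonneg (mul_nonneg (by positivity : (0:R) ≤ cJJP) (by positivity : (0:R) ≤ uMJ)) (by positivity : (0:R) ≤ uMJ * uMJP ^ 2)
  have H218 := mul_nonneg (mul_nonneg (by positivity : (0:R) ≤ uM) (by positivity : (0:R) ≤ uJ)) (by positivity : (0:R) ≤ uMJ * uMJP ^ 2)
  have H219 := mul_nonneg (mul_nonneg (by positivity : (0:R) ≤ uM) (by positivity : (0:R) ≤ uMJ)) (by positivity : (0:R) ≤ uMJP ^ 2 * uJJP)
  exact add_nonneg (add_nonneg (add_nonneg (add_nonneg (add_nonneg (add_nonneg (add_nonneg (add_nonneg (add_nonneg (add_nonneg (add_nonneg (add_nonneg (add_nonneg (add_nonneg (add_nonneg (add_nonneg (add_nonneg (add_nonneg (add_nonneg (mul_nonneg (by norm_num : (0:R) ≤ (2 : R)) H200) (mul_nonneg (by norm_num : (0:R) ≤ (2 : R)) H201)) (mul_nonneg (by norm_num : (0:R) ≤ (2 : R)) H202)) (mul_nonneg (by norm_num : (0:R) ≤ (2 : R)) H203)) (mul_nonneg (by norm_num : (0:R) ≤ (2 : R)) H204)) (mul_nonneg (by norm_num :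 (0:R) ≤ (2 : R)) H205)) (mul_nonneg (by norm_num : (0:R) ≤ (2 : R)) H206)) (mul_nonneg (by norm_num : (0:R) ≤ (2 : R)) H207)) (mul_nonneg (by norm_num : (0:R) ≤ (2 : R)) H208)) (mul_nonneg (by norm_num : (0:R) ≤ (2 : R)) H209)) (mul_nonneg (by norm_num : (0:R) ≤ (2 : R)) H210)) (mul_nonneg (by norm_num : (0:R) ≤ (2 : R)) H211)) (mul_nonneg (by norm_num : (0:R) ≤ (2 : R)) H212)) (mul_nonneg (by norm_num : (0:R) ≤ (2 : R)) H213)) (mul_nonneg (by norm_num : (0:R) ≤ (2 : R)) H214)) (mul_nonneg (by norm_num : (0:R) ≤ (2 : R)) H215)) (mul_nonneg (by norm_num : (0:R) ≤ (2 : R)) H216)) (mul_nonneg (by norm_num : (0:R) ≤ (2 : R)) H217)) (mul_nonneg (by norm_num : (0:R) ≤ (2 : R)) H218)) (mul_nonneg (by norm_num : (0:R) ≤ (2 : R)) H219)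
omit [LinearOrder R] [IsStrictOrderedRing R] in
set_option maxHeartbeats 3200000 in
set_option maxRecDepth 100000 in
/-- Chunk 11 of the certificate identity. -/
lemma jp_corner_mj_mjp_chunk11_eq (_cO _cM _cJ _cMJ _cJP _cMJP _cJJP _cMJJP _uO _uM uJ uMJ uJP uMJP _uJJP _uMJJP : R) :
    (2 : R) * uMJ ^ 3 * uJP * uMJP + (2 : R) * uJ * uMJ * uMJP ^ 3 = (2 : R) * (uJ * uMJ * (uMJP ^ 3)) + (2 : R) * (uMJ * uMJ * (uMJ * uJP * uMJP)) := by
  ring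

set_option maxHeartbeats 3200000 in
set_option maxRecDepth 100000 in
/-- Chunk 11 of the certificate is nonnegative. -/
lemma jp_corner_mj_mjp_chunk11_nonneg (cO cM cJ cMJ cJP cMJP cJJP cMJJP uO uM uJ uMJ uJP uMJP uJJP uMJJP : R)
    (_hcO : 0 ≤ cO) (_hcM : 0 ≤ cM) (_hcJ : 0 ≤ cJ) (_hcMJ : 0 ≤ cMJ) (_hcJP : 0 ≤ cJP) (_hcMJP : 0 ≤ cMJP) (_hcJJP : 0 ≤ cJJP) (_hcMJJP : 0 ≤ cMJJP) (_huO : 0 ≤ uO) (_huM : 0 ≤ uM) (_huJ : 0 ≤ uJ) (_huMJ : 0 ≤ uMJ) (_huJP : 0 ≤ uJP) (_huMJP : 0 ≤ uMJP) (_huJJP : 0 ≤ uJJP) (_huMJJP : 0 ≤ uMJJP)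
    (_hord_o : uO ≤ cO) (_hord_m : uM ≤ cM) (_hord_j : uJ ≤ cJ) (_hord_mj : uMJ ≤ cMJ) (_hord_jp : uJP ≤ cJP) (_hord_mjp : uMJP ≤ cMJP) (_hord_jjp : uJJP ≤ cJJP) (_hord_mjjp : uMJJP ≤ cMJJP)
     :
    0 ≤ (2 : R) * uMJ ^ 3 * uJP * uMJP + (2 : R) * uJ * uMJ * uMJP ^ 3 := by
  rw [jp_corner_mj_mjp_chunk11_eq cO cM cJ cMJ cJP cMJP cJJP cMJJP uO uM uJ uMJ uJP uMJP uJJP uMJJP]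
  have H220 := mul_nonneg (mul_nonneg (by positivity : (0:R) ≤ uJ) (by positivity : (0:R) ≤ uMJ)) (by positivity : (0:R) ≤ uMJP ^ 3)
  have H221 := mul_nonneg (mul_nonneg (by positivity : (0:R) ≤ uMJ) (by positivity : (0:R) ≤ uMJ)) (by positivity : (0:R) ≤ uMJ * uJP * uMJP)
  exact add_nonneg (mul_nonneg (by norm_num : (0:R) ≤ (2 : R)) H220) (mul_nonneg (by norm_num : (0:R) ≤ (2 : R)) H221)

end JpCornerPart

end Summit.Ventures.PercRepro2.Coin
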